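import Summits.Parity.GeneralizedHardyLittlewood.Theorems.LiouvilleMADTypeIIToLevelTypeI1
import Summits.Parity.GeneralizedHardyLittlewood.Theorems.LiouvilleShiftedTablesBVLiouville
import Literature.NumberTheory.Sieve.DivisorPowerSums

/-!
# `TypeIIToLevel` (route `LiouvilleMAD`), part 4b: the type-I budget from Bombieri–Vinogradov for `λ`

Support file for the item stmt-Parity-14996
(`Summit.Parity.GeneralizedHardyLittlewood.Theses.LiouvilleMAD.TypeIIToLevel`).

* `exists_bv_max`: the tree theorem `BVLiouville` (Bombieri–Vinogradov for `λ`, one residue and one height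
  per modulus, level `x^{1/2−ε}`; proof `BVLiouville_proof`) in MAX form at an integer height `X`: data
  `G r ≥ max_{c < r, J ≤ X/r} |∑_{j ≤ J} λ(rj + c)|` with `G r ≤ X/r` and `∑_{r ≤ X^{9/20}} G r ≤ C X (log X)^{−A}`
  (the maximising residue and height per modulus exist because both range over finite sets).
* `typeI_budget`: for `QD ≤ X^{9/20}` the type-I sums of the class weights `1[· ≡ w (q)] λ(· + h)`,
  `q ≤ Q`, along `d ≤ D`, are bounded by `F q d = 2(G(lcm(d,q)) + 1)` (part 4a) and
  `∑_{q ≤ Q} ∑_{d ≤ D} F q d ≤ C X (log X)^{−A}`: the multiplicity of `r` as an `lcm(d, q)` is at most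
  `τ(r)²`, and Cauchy–Schwarz against the trivial bound `G r ≤ X/r` with the divisor moment
  `∑ τ(r)⁴/r ≪ (log X)^{32}` (`Literature.NumberTheory.Sieve.exists_sum_sigma_zero_pow_div_le`) loses only a
  power of `log X`.
-/

noncomputable section

open Finset Real ArithmeticFunction
open Literature.NumberTheory.LFunctions.LiouvilleSum (abs_liouville_le_one)
open scoped ArithmeticFunction.sigma

namespace Summit.Parity.GeneralizedHardyLittlewood.Theorems.TypeIIToLevel

open Summit.Parity.GeneralizedHardyLittlewood.Cruxes.TypeI2Dilated.PeelToDrappeau (BVLiouville_proof)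

/-! ### Bombieri–Vinogradov for `λ` in max form -/

/-- **Bombieri–Vinogradov for `λ`, max form at an integer height**: for `A > 0` there are `C, X₀` such that
for every integer `X ≥ X₀` there is `G : ℕ → ℝ`, `0 ≤ G r ≤ X/r`, dominating
`|∑_{j ≤ J} λ(rj + c)|` for all `0 ≤ c < r`, `J ≤ X/r`, with `∑_{1 ≤ r ≤ X^{1/2 − 1/20}} G r ≤ C X (log X)^{−A}`.
From the tree theorem `BVLiouville` (`BVLiouville_proof`) at the maximising residue and height per modulus.
[folklore] -/
theorem exists_bv_max {A : ℝ} (hA : 0 < A) :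
    ∃ C : ℝ, ∃ X₀ : ℕ, ∀ X : ℕ, X₀ ≤ X → ∃ G : ℕ → ℝ, (∀ r, 0 ≤ G r) ∧
      (∀ r c J : ℕ, 1 ≤ r → c < r → J ≤ X / r →
        |∑ j ∈ Icc 1 J, (liouville (Int.toNat ((r : ℤ) * j + c)) : ℝ)| ≤ G r) ∧
      (∀ r, 1 ≤ r → G r ≤ (X : ℝ) / r) ∧
      ∑ r ∈ Icc 1 ⌊(X : ℝ) ^ (1 / 2 - 1 / 20 : ℝ)⌋₊, G r ≤ C * X / Real.log X ^ A := by
  obtain ⟨C, x₀, hBV⟩ := BVLiouville_proof (1 / 20) (by norm_num) A hA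
  refine ⟨C, ⌈max x₀ 0⌉₊, fun X hX => ?_⟩
  have hXx₀ : x₀ ≤ (X : ℝ) := le_trans ((le_max_left _ _).trans (Nat.le_ceil _)) (by exact_mod_cast hX)
  -- the sums and their trivial bound
  set S : ℕ → ℕ → ℕ → ℝ := fun r c J =>
    |∑ j ∈ Icc 1 J, (liouville (Int.toNat ((r : ℤ) * j + c)) : ℝ)| with hS
  have hStriv : ∀ r c J : ℕ, S r c J ≤ J := by
    intro r c J
    simp only [hS]
    refine (abs_sum_le_sum_abs _ _).trans ?_
    calc ∑ j ∈ Icc 1 J, |(liouville (Int.toNat ((r : ℤ) * j + c)) : ℝ)| ≤ ∑ _j ∈ Icc 1 J, (1 : ℝ) :=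
          sum_le_sum fun j _ => abs_liouville_le_one _
      _ = J := by simp
  have hJX : ∀ r J : ℕ, 1 ≤ r → J ≤ X / r → (J : ℝ) ≤ (X : ℝ) / r := by
    intro r J hr hJ
    have hr0 : (0 : ℝ) < r := by exact_mod_cast hr
    rw [le_div_iff₀ hr0]
    have : J * r ≤ X := (Nat.le_div_iff_mul_le hr).1 hJ
    exact_mod_cast this
  -- the maximum per modulus
  have key : ∀ r : ℕ, ∃ g : ℝ, 0 ≤ g ∧ (∀ c J : ℕ, c < r → J ≤ X / r → S r c J ≤ g) ∧
      (1 ≤ r → g ≤ (X : ℝ) / r) ∧ (∃ c J : ℕ, 1 ≤ r → (c < r ∧ J ≤ X / r ∧ g = S r c J)) := by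
    intro r
    rcases Nat.eq_zero_or_pos r with rfl | hr
    · exact ⟨0, le_rfl, fun c J hc _ => absurd hc (Nat.not_lt_zero c), fun h => absurd h (by norm_num),
        ⟨0, 0, fun h => absurd h (by norm_num)⟩⟩
    · set s : Finset (ℕ × ℕ) := range r ×ˢ range (X / r + 1) with hs
      have hne : s.Nonempty := ⟨(0, 0), by simp [hs, hr]⟩
      obtain ⟨p, hp, hmax⟩ := exists_max_image s (fun p => S r p.1 p.2) hne
      have hp' : p.1 < r ∧ p.2 ≤ X / r := by
        simp only [hs, mem_product, mem_range] at hp; omega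
      refine ⟨S r p.1 p.2, abs_nonneg _, fun c J hc hJ => ?_, fun _ => ?_, ⟨p.1, p.2, fun _ => ⟨hp'.1, hp'.2, rfl⟩⟩⟩
      · exact hmax (c, J) (by simp only [hs, mem_product, mem_range]; omega)
      · exact (hStriv r p.1 p.2).trans (hJX r p.2 hr hp'.2)
  choose G hG0 hGmax hGtriv hGw using key
  choose cw Jw hcJ using hGw
  refine ⟨G, hG0, fun r c J hr hc hJ => hGmax r c J hc hJ, hGtriv, ?_⟩
  -- Bombieri–Vinogradov at the maximising data
  set cf : ℕ → ℤ := fun r => (cw r : ℤ) with hcf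
  set yf : ℕ → ℝ := fun r => if 1 ≤ r then (r : ℝ) * (Jw r) else 0 with hyf
  have hc : ∀ d, 1 ≤ d → 0 ≤ cf d ∧ cf d < d := by
    intro d hd
    refine ⟨by simp [hcf], ?_⟩
    simp only [hcf]; exact_mod_cast (hcJ d hd).1
  have hy : ∀ d, 0 ≤ yf d ∧ yf d ≤ X := by
    intro d
    simp only [hyf]
    split_ifs with hd
    · refine ⟨by positivity, ?_⟩
      have h1 := hJX d (Jw d) hd (hcJ d hd).2.1
      have hd0 : (0 : ℝ) < d := by exact_mod_cast hd
      rwa [le_div_iff₀ hd0, mul_comm] at h1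
    · exact ⟨le_rfl, Nat.cast_nonneg X⟩
  have hmain := hBV X hXx₀ cf yf hc hy
  refine le_trans (le_of_eq ?_) hmain
  refine sum_congr rfl fun d hd => ?_
  have hd1 : 1 ≤ d := (mem_Icc.1 hd).1
  have hd0 : (0 : ℝ) < d := by exact_mod_cast hd1
  have hfloor : ⌊yf d / d⌋₊ = Jw d := by
    simp only [hyf, if_pos hd1]
    rw [mul_div_cancel_left₀ _ hd0.ne', Nat.floor_natCast]
  rw [hfloor, (hcJ d hd1).2.2]

/-! ### The multiplicity of `lcm` -/

/-- The number of pairs `(q, d) ∈ [1, Q] × [1, D]` with `lcm(d, q) = r ≥ 1` is at most `τ(r)²`. [folklore] -/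
theorem card_filter_lcm_eq_le (Q D : ℕ) {r : ℕ} (hr : r ≠ 0) :
    #((Icc 1 Q ×ˢ Icc 1 D).filter (fun p : ℕ × ℕ => Nat.lcm p.2 p.1 = r)) ≤ σ 0 r ^ 2 := by
  calc #((Icc 1 Q ×ˢ Icc 1 D).filter (fun p : ℕ × ℕ => Nat.lcm p.2 p.1 = r))
      ≤ #(r.divisors ×ˢ r.divisors) := by
        refine card_le_card fun p hp => ?_
        rw [mem_filter] at hp
        rw [mem_product, Nat.mem_divisors, Nat.mem_divisors]
        refine ⟨⟨?_, hr⟩, ⟨?_, hr⟩⟩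
        · rw [← hp.2]; exact Nat.dvd_lcm_right _ _
        · rw [← hp.2]; exact Nat.dvd_lcm_left _ _
    _ = σ 0 r ^ 2 := by rw [card_product, sigma_zero_apply, sq]

/-! ### The type-I budget -/

/-- **The type-I budget**: for `h ∈ ℤ` and `A > 0` there are `C, X₀` such that for all integers
`X ≥ X₀` and all `Q, D` with `QD ≤ X^{1/2 − 1/20}` there is `F : ℕ → ℕ → ℝ`, `F ≥ 0`, with
`|∑_{m ≤ t} 1[dm ≡ w (q)] λ(dm + h)| ≤ F q d` for all `q, d ≥ 1`, all residues `w` and all `t` with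
`dt + h ≤ X`, and `∑_{q ≤ Q} ∑_{d ≤ D} F q d ≤ C X (log X)^{−A}`.  (`F q d = 2(G(lcm(d,q)) + 1)` with the
Bombieri–Vinogradov data `G` of `exists_bv_max`; multiplicities `≤ τ(r)²` and Cauchy–Schwarz against
`G r ≤ X/r` with `∑ τ⁴/r ≪ log³² X`.) [folklore] -/
theorem typeI_budget (h : ℤ) {A : ℝ} (hA : 0 < A) :
    ∃ C : ℝ, ∃ X₀ : ℕ, ∀ X : ℕ, X₀ ≤ X → ∀ Q D : ℕ,
      ((Q * D : ℕ) : ℝ) ≤ (X : ℝ) ^ (1 / 2 - 1 / 20 : ℝ) →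
      ∃ F : ℕ → ℕ → ℝ, (∀ q d, 0 ≤ F q d) ∧
        (∀ q d w t : ℕ, 1 ≤ q → 1 ≤ d → ((d * t : ℕ) : ℤ) + h ≤ X →
          |∑ m ∈ Ioc 0 t, (if d * m ≡ w [MOD q] then
            (liouville (Int.toNat (((d * m : ℕ) : ℤ) + h)) : ℝ) else 0)| ≤ F q d) ∧
        ∑ q ∈ Icc 1 Q, ∑ d ∈ Icc 1 D, F q d ≤ C * X / Real.log X ^ A := by
  -- constants
  obtain ⟨C₁, X₁, hBV⟩ := exists_bv_max (A := 2 * A + 34) (by linarith)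
  obtain ⟨C₄, hC₄, hτ⟩ := Literature.NumberTheory.Sieve.exists_sum_sigma_zero_pow_div_le 4
  have hev : ∀ᶠ x : ℝ in Filter.atTop, Real.log x ^ (A + 1) ≤ x ^ (1 / 2 : ℝ) :=
    Literature.NumberTheory.Sieve.eventually_log_rpow_le_rpow (A + 1) (by norm_num)
  obtain ⟨x₂, hx₂⟩ := Filter.eventually_atTop.1 (hev.and (Filter.eventually_ge_atTop (8 : ℝ)))
  set C₁' : ℝ := max C₁ 0 with hC₁'
  have hC₁'0 : 0 ≤ C₁' := le_max_right _ _
  set K : ℝ := Real.sqrt (C₄ * C₁') with hK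
  have hK0 : 0 ≤ K := Real.sqrt_nonneg _
  refine ⟨2 + 2 * K, max X₁ ⌈x₂⌉₊, fun X hX Q D hQD => ?_⟩
  have hX₁ : X₁ ≤ X := le_of_max_le_left hX
  have hXx₂ : x₂ ≤ X := (Nat.le_ceil x₂).trans (by exact_mod_cast le_of_max_le_right hX)
  obtain ⟨hlogX, hX8⟩ := hx₂ X hXx₂
  have hX0 : (0 : ℝ) < X := by linarith
  set L : ℝ := Real.log X with hL
  have hL1 : 1 ≤ L := by
    rw [hL, ← Real.log_exp 1]
    refine Real.log_le_log (Real.exp_pos 1) (le_trans ?_ hX8)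
    have := Real.exp_one_lt_d9; norm_num at this ⊢; linarith
  have hL0 : 0 < L := by linarith
  obtain ⟨G, hG0, hGmax, hGtriv, hGsum⟩ := hBV X hX₁
  refine ⟨fun q d => 2 * (G (Nat.lcm d q) + 1), fun q d => by have := hG0 (Nat.lcm d q); positivity, ?_, ?_⟩
  · intro q d w t hq hd hX'
    exact abs_sum_typeI_le hd hq w h hX' (fun c J hc hJ => hGmax _ c J (Nat.lcm_pos hd hq) hc hJ)
  · -- the budget: `2QD + 2 ∑∑ G(lcm)`
    have hsplit : ∑ q ∈ Icc 1 Q, ∑ d ∈ Icc 1 D, 2 * (G (Nat.lcm d q) + 1) =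
        2 * ∑ q ∈ Icc 1 Q, ∑ d ∈ Icc 1 D, G (Nat.lcm d q) + 2 * ((Q * D : ℕ) : ℝ) := by
      have hinner : ∀ q ∈ Icc 1 Q, ∑ d ∈ Icc 1 D, 2 * (G (Nat.lcm d q) + 1) =
          2 * ∑ d ∈ Icc 1 D, G (Nat.lcm d q) + 2 * D := by
        intro q _
        have : ∀ d ∈ Icc 1 D, 2 * (G (Nat.lcm d q) + 1) = 2 * G (Nat.lcm d q) + 2 := fun d _ => by ring
        rw [sum_congr rfl this, sum_add_distrib, sum_const, Nat.card_Icc, Nat.add_sub_cancel, nsmul_eq_mul,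
          ← mul_sum]
        ring
      rw [sum_congr rfl hinner, sum_add_distrib, sum_const, Nat.card_Icc, Nat.add_sub_cancel, nsmul_eq_mul,
        ← mul_sum]
      push_cast; ring
    -- the level: `R₂ = max(QD, 2) ≤ X^{9/20}`
    set R₂ : ℕ := max (Q * D) 2 with hR₂
    have hR₂2 : 2 ≤ R₂ := le_max_right _ _
    have h2X : (2 : ℝ) ≤ (X : ℝ) ^ (1 / 2 - 1 / 20 : ℝ) := by
      have h8 : (2 : ℝ) = (8 : ℝ) ^ (1 / 3 : ℝ) := by
        rw [show (8 : ℝ) = (2 : ℝ) ^ (3 : ℕ) by norm_num, ← Real.rpow_natCast, ← Real.rpow_mul (by norm_num)]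
        norm_num
      calc (2 : ℝ) = (8 : ℝ) ^ (1 / 3 : ℝ) := h8
        _ ≤ (X : ℝ) ^ (1 / 3 : ℝ) := Real.rpow_le_rpow (by norm_num) hX8 (by norm_num)
        _ ≤ (X : ℝ) ^ (1 / 2 - 1 / 20 : ℝ) := Real.rpow_le_rpow_of_exponent_le (by linarith) (by norm_num)
    have hR₂X : (R₂ : ℝ) ≤ (X : ℝ) ^ (1 / 2 - 1 / 20 : ℝ) := by
      rw [hR₂]; push_cast; exact max_le (by exact_mod_cast hQD) h2X
    have hR₂le : R₂ ≤ ⌊(X : ℝ) ^ (1 / 2 - 1 / 20 : ℝ)⌋₊ := Nat.le_floor hR₂X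
    have hR₂X' : (R₂ : ℝ) ≤ X := hR₂X.trans (by
      simpa using Real.rpow_le_rpow_of_exponent_le (by linarith : (1 : ℝ) ≤ X) (by norm_num : (1 / 2 - 1 / 20 : ℝ) ≤ 1))
    -- fiberwise by `r = lcm(d, q)`
    set P : Finset (ℕ × ℕ) := Icc 1 Q ×ˢ Icc 1 D with hP
    set m : ℕ → ℝ := fun r => (#(P.filter (fun p : ℕ × ℕ => Nat.lcm p.2 p.1 = r)) : ℝ) with hm
    have hm0 : ∀ r, 0 ≤ m r := fun r => Nat.cast_nonneg _
    have hmaps : ∀ p ∈ P, Nat.lcm p.2 p.1 ∈ Icc 1 R₂ := by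
      intro p hp
      rw [hP, mem_product, mem_Icc, mem_Icc] at hp
      have h1 : 0 < Nat.lcm p.2 p.1 := Nat.lcm_pos hp.2.1 hp.1.1
      have h2 : Nat.lcm p.2 p.1 ≤ p.2 * p.1 := Nat.le_of_dvd (Nat.mul_pos hp.2.1 hp.1.1) (Nat.lcm_dvd_mul _ _)
      refine mem_Icc.2 ⟨h1, le_trans ?_ (le_max_left _ _)⟩
      calc Nat.lcm p.2 p.1 ≤ p.2 * p.1 := h2
        _ ≤ D * Q := Nat.mul_le_mul hp.2.2 hp.1.2
        _ = Q * D := mul_comm _ _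
    have hfib : ∑ q ∈ Icc 1 Q, ∑ d ∈ Icc 1 D, G (Nat.lcm d q) = ∑ r ∈ Icc 1 R₂, m r * G r := by
      rw [← sum_product' (f := fun q d => G (Nat.lcm d q)), ← sum_fiberwise_of_maps_to hmaps]
      refine sum_congr rfl fun r _ => ?_
      rw [sum_congr rfl fun p hp => by rw [(mem_filter.1 hp).2], sum_const, nsmul_eq_mul]
    have hmτ : ∀ r ∈ Icc 1 R₂, m r ≤ (σ 0 r : ℝ) ^ 2 := by
      intro r hr
      have hr0 : r ≠ 0 := by have := (mem_Icc.1 hr).1; omega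
      simp only [hm]
      exact_mod_cast card_filter_lcm_eq_le Q D hr0
    -- Cauchy–Schwarz against the trivial bound
    have hCS := Real.sum_mul_le_sqrt_mul_sqrt (Icc 1 R₂) (fun r => m r * Real.sqrt (G r)) (fun r => Real.sqrt (G r))
    have hlhs : ∑ r ∈ Icc 1 R₂, m r * Real.sqrt (G r) * Real.sqrt (G r) = ∑ r ∈ Icc 1 R₂, m r * G r := by
      refine sum_congr rfl fun r _ => ?_
      rw [mul_assoc, Real.mul_self_sqrt (hG0 r)]
    have h1 : ∑ r ∈ Icc 1 R₂, (m r * Real.sqrt (G r)) ^ 2 ≤ X * (C₄ * L ^ (32 : ℕ)) := by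
      calc ∑ r ∈ Icc 1 R₂, (m r * Real.sqrt (G r)) ^ 2 = ∑ r ∈ Icc 1 R₂, m r ^ 2 * G r := by
            refine sum_congr rfl fun r _ => ?_; rw [mul_pow, Real.sq_sqrt (hG0 r)]
        _ ≤ ∑ r ∈ Icc 1 R₂, (X : ℝ) * ((σ 0 r : ℝ) ^ 4 / r) := by
            refine sum_le_sum fun r hr => ?_
            have hr1 : 1 ≤ r := (mem_Icc.1 hr).1
            have hr0 : (0 : ℝ) < r := by exact_mod_cast hr1
            have hm2 : m r ^ 2 ≤ ((σ 0 r : ℝ) ^ 2) ^ 2 := pow_le_pow_left₀ (hm0 r) (hmτ r hr) 2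
            calc m r ^ 2 * G r ≤ ((σ 0 r : ℝ) ^ 2) ^ 2 * ((X : ℝ) / r) :=
                  mul_le_mul hm2 (hGtriv r hr1) (hG0 r) (by positivity)
              _ = (X : ℝ) * ((σ 0 r : ℝ) ^ 4 / r) := by ring
        _ = X * ∑ r ∈ Icc 1 R₂, (σ 0 r : ℝ) ^ 4 / r := by rw [mul_sum]
        _ ≤ X * (C₄ * Real.log R₂ ^ (2 ^ (4 + 1))) := mul_le_mul_of_nonneg_left (hτ R₂ hR₂2) hX0.le
        _ ≤ X * (C₄ * L ^ (32 : ℕ)) := by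
            refine mul_le_mul_of_nonneg_left (mul_le_mul_of_nonneg_left ?_ hC₄.le) hX0.le
            have hlogR : Real.log R₂ ≤ L := Real.log_le_log (by positivity) hR₂X'
            have hlogR0 : 0 ≤ Real.log R₂ := Real.log_natCast_nonneg _
            norm_num
            exact pow_le_pow_left₀ hlogR0 hlogR 32
    have h2 : ∑ r ∈ Icc 1 R₂, Real.sqrt (G r) ^ 2 ≤ C₁' * X / L ^ (2 * A + 34) := by
      calc ∑ r ∈ Icc 1 R₂, Real.sqrt (G r) ^ 2 = ∑ r ∈ Icc 1 R₂, G r :=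
            sum_congr rfl fun r _ => Real.sq_sqrt (hG0 r)
        _ ≤ ∑ r ∈ Icc 1 ⌊(X : ℝ) ^ (1 / 2 - 1 / 20 : ℝ)⌋₊, G r :=
            sum_le_sum_of_subset_of_nonneg (Icc_subset_Icc_right hR₂le) fun r _ _ => hG0 r
        _ ≤ C₁ * X / L ^ (2 * A + 34) := hGsum
        _ ≤ C₁' * X / L ^ (2 * A + 34) := by
            have : 0 < L ^ (2 * A + 34) := Real.rpow_pos_of_pos hL0 _
            gcongr
            exact le_max_left _ _
    -- the two square roots
    have hs1 : Real.sqrt (X * (C₄ * L ^ (32 : ℕ))) = Real.sqrt (X * C₄) * L ^ (16 : ℕ) := by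
      rw [show (X : ℝ) * (C₄ * L ^ (32 : ℕ)) = (X * C₄) * (L ^ (16 : ℕ)) ^ 2 by ring,
        Real.sqrt_mul (by positivity), Real.sqrt_sq (by positivity)]
    have hs2 : Real.sqrt (C₁' * X / L ^ (2 * A + 34)) = Real.sqrt (C₁' * X) / L ^ (A + 17) := by
      rw [Real.sqrt_div (by positivity), Real.sqrt_eq_rpow (L ^ (2 * A + 34)), ← Real.rpow_mul hL0.le]
      congr 2; ring
    have hM : ∑ r ∈ Icc 1 R₂, m r * G r ≤ K * X / L ^ (A + 1) := by
      rw [← hlhs]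
      refine hCS.trans ?_
      calc Real.sqrt (∑ r ∈ Icc 1 R₂, (m r * Real.sqrt (G r)) ^ 2) * Real.sqrt (∑ r ∈ Icc 1 R₂, Real.sqrt (G r) ^ 2)
          ≤ Real.sqrt (X * (C₄ * L ^ (32 : ℕ))) * Real.sqrt (C₁' * X / L ^ (2 * A + 34)) :=
            mul_le_mul (Real.sqrt_le_sqrt h1) (Real.sqrt_le_sqrt h2) (Real.sqrt_nonneg _) (Real.sqrt_nonneg _)
        _ = K * X / L ^ (A + 1) := by
            rw [hs1, hs2, hK]
            have hXX : Real.sqrt (X * C₄) * Real.sqrt (C₁' * X) = Real.sqrt (C₄ * C₁') * X := by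
              rw [← Real.sqrt_mul (by positivity), show (X : ℝ) * C₄ * (C₁' * X) = (C₄ * C₁') * X ^ 2 by ring,
                Real.sqrt_mul (by positivity), Real.sqrt_sq hX0.le]
            have hLL : L ^ (A + 17) = L ^ (16 : ℕ) * L ^ (A + 1) := by
              rw [← Real.rpow_natCast L 16, ← Real.rpow_add hL0]; congr 1; push_cast; ring
            have h16 : 0 < L ^ (16 : ℕ) := by positivity
            calc Real.sqrt (X * C₄) * L ^ (16 : ℕ) * (Real.sqrt (C₁' * X) / L ^ (A + 17))
                = L ^ (16 : ℕ) * (Real.sqrt (X * C₄) * Real.sqrt (C₁' * X)) / (L ^ (16 : ℕ) * L ^ (A + 1)) := by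
                  rw [hLL]; ring
              _ = Real.sqrt (C₄ * C₁') * X / L ^ (A + 1) := by
                  rw [hXX, mul_div_mul_left _ _ h16.ne']
    -- collect
    rw [hsplit, hfib]
    have hQD : ((Q * D : ℕ) : ℝ) ≤ X / L ^ A := by
      have hA0 : 0 < L ^ A := Real.rpow_pos_of_pos hL0 _
      rw [le_div_iff₀ hA0]
      have hLA : L ^ A ≤ L ^ (A + 1) := Real.rpow_le_rpow_of_exponent_le hL1 (by linarith)
      have hhalf : (X : ℝ) ^ (1 / 2 - 1 / 20 : ℝ) * (X : ℝ) ^ (1 / 2 : ℝ) ≤ X := by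
        rw [← Real.rpow_add hX0]
        calc (X : ℝ) ^ (1 / 2 - 1 / 20 + 1 / 2 : ℝ) ≤ (X : ℝ) ^ (1 : ℝ) :=
              Real.rpow_le_rpow_of_exponent_le (by linarith) (by norm_num)
          _ = X := Real.rpow_one _
      calc ((Q * D : ℕ) : ℝ) * L ^ A ≤ (X : ℝ) ^ (1 / 2 - 1 / 20 : ℝ) * (X : ℝ) ^ (1 / 2 : ℝ) :=
            mul_le_mul hQD (hLA.trans hlogX) hA0.le (by positivity)
        _ ≤ X := hhalf
    have hMA : K * X / L ^ (A + 1) ≤ K * X / L ^ A := by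
      have hA0 : 0 < L ^ A := Real.rpow_pos_of_pos hL0 _
      have hLA : L ^ A ≤ L ^ (A + 1) := Real.rpow_le_rpow_of_exponent_le hL1 (by linarith)
      exact div_le_div_of_nonneg_left (by positivity) hA0 hLA
    calc 2 * ∑ r ∈ Icc 1 R₂, m r * G r + 2 * ((Q * D : ℕ) : ℝ) ≤ 2 * (K * X / L ^ A) + 2 * (X / L ^ A) := by
          linarith [hM.trans hMA]
      _ = (2 + 2 * K) * X / L ^ A := by ring

end Summit.Parity.GeneralizedHardyLittlewood.Theorems.TypeIIToLevel

end
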